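import Mathlib
import Literature.Computability.AlgebraicComplexity.FermionicPencil
import Literature.Computability.AlgebraicComplexity.FermionantCompletenessProofs
import Literature.Computability.AlgebraicComplexity.ValiantClassesProofs
import Literature.Computability.AlgebraicComplexity.ValiantCompleteness
import Literature.Computability.AlgebraicComplexity.HamiltonianCycleVNP
import Literature.LinearAlgebra.Matrix.PermanentSubperm
import Literature.Combinatorics.Enumerative.PermanentLaplaceExpansion
import Summits.ValiantsHypothesis.ValiantsHypothesis.Theorems.FermionicJetHcProjectsToCdetCycles
import Summits.ValiantsHypothesis.ValiantsHypothesis.Theses.FermionicJet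
import HarnessLib

/-!
# ValiantsHypothesis / FermionicJet — `HcProjectsToCdet`: `HC` is a p-projection of `cdet`

Settles item `stmt-ValiantsHypothesis-5342` (`HcProjectsToCdet`, route `FermionicJet`, crux rank 3): the
Hamiltonian cycle family `(HC_n)_n` is a p-projection of the cycle-counting determinant
`cdet_n = ∑_σ sgn σ · c(σ) · ∏ᵢ X_{σ i, i}` (`c(σ)` = number of cycles, fixed points included; the first
Taylor coefficient of the fermionic pencil `∑_σ sgn σ · t^{c(σ)} x^σ` at the free-fermion point `t = 1`).
Consequently `cdet` is `VNP`-complete under p-projections over `ℂ` (with the tree's `jetsInVNP_proof`), and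
the route's rank-2 crux `FirstOrderHardness` (`cdet ∉ VP`) is EQUIVALENT to Valiant's hypothesis.

## Proof

`HC ≤_p per ≤_p cdet`, composed by `IsPProjection.trans_holds`.

* `per ≤_p cdet` (`isPProjection_perPoly_cdetPoly`, size `N(n) = 2(n+1) + (n+1)²`). The sign is broken with
  the cycle count by de Rugy-Altherre's AVERAGING GRAPH (`Literature…DeRugyAltherre.MB`, Stage B of the
  tree's proof of `DeRugyAltherre2013_thm1`): `inl i → p_{ij}` (weight `Z i j`), `p_{ij} → inr j`,
  `inr j → inl b` for ALL `b`. A cycle cover picks a bijection `τ` (the matrix monomial `∏ Z i (τ i)`) and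
  an arbitrary return bijection `γ`; its cycles are those of `γτ`, so the fermionic pencil of the graph is
  `per Z · ∑_{ψ ∈ S_m} sgn ψ λ^{c(ψ)} = per Z · λ(λ-1)⋯(λ-m+1)` (up to the unit loops of unused pass
  vertices): the determinant of the graph VANISHES (`λ = 1`), but the derivative there — `cdet` — is
  `(-1)^m (m-2)! · per Z`. The block-diagonal obstruction of the route text (`cdet(A ⊕ B) = cdet A det B +
  det A cdet B`) is evaded because the return layer is one global, non-local gadget. The identity is
  `FermionicJetHcProjectsToCdet.aeval_MB_cdetPoly` (part 1 of this pair of files,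
  `FermionicJetHcProjectsToCdetCycles.lean`); here it is applied to
  `Z = X ⊕ (c_n)` with the constant `c_n = ((-1)^N q_n)⁻¹` absorbing the scalar
  (`Matrix.permanent_fromBlocks_zero₂₁`), so that `per_n = cdet_{N(n)}(substitution)` on the nose.
* `HC ≤_p per` (`isPProjection_hcPoly_perPoly`): Valiant's completeness of the permanent
  (tree: `isVNPComplete_perPoly_holds`, `char ℂ ≠ 2`) applied to `HC ∈ VNP` (`isVNPFamily_hcPoly_holds`),
  with the variables bundled along `Fin n × Fin n ≃ Fin (n·n)` and un-renamed
  (`isProjection_of_rename_equiv`).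

No named facts are assumed; VP ≠ VNP itself is of course not touched by this completeness result.
-/

noncomputable section

set_option linter.dupNamespace false -- single-conjunct summit: `ValiantsHypothesis.ValiantsHypothesis`

open Equiv Equiv.Perm Finset
open Literature.Computability.AlgebraicComplexity
open Literature.Computability.AlgebraicComplexity.DeRugyAltherre

namespace Summit.ValiantsHypothesis.ValiantsHypothesis.Theorems

namespace FermionicJetHcProjectsToCdet

/-! ### The permanent is a projection of `cdet` -/

section PerToCdet

variable (n : ℕ)

/-- `per (X ⊕ (c)) = c · per X` for the generic `n × n` matrix padded with one diagonal constant.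
[folklore] -/
theorem permanent_pad (c : ℂ) :
    (Matrix.submatrix (Matrix.fromBlocks (Matrix.mvPolynomialX (Fin n) (Fin n) ℂ) 0 0
        (fun _ _ : Fin 1 => MvPolynomial.C c)) ⇑finSumFinEquiv.symm ⇑finSumFinEquiv.symm).permanent =
      MvPolynomial.C c * perPoly (Fin n) ℂ := by
  rw [Literature.Combinatorics.Enumerative.permanent_submatrix_equiv_equiv,
    Matrix.permanent_fromBlocks_zero₂₁,
    Matrix.permanent_unique (fun _ _ : Fin 1 => (MvPolynomial.C c : MvPolynomial (Fin n × Fin n) ℂ)),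
    perPoly, mul_comm]

/-- The entries of `X ⊕ (c)` are variables or constants. [folklore] -/
theorem pad_VOC (c : ℂ) (i j : Fin (n + 1)) :
    VOC ((Matrix.submatrix (Matrix.fromBlocks (Matrix.mvPolynomialX (Fin n) (Fin n) ℂ) 0 0
        (fun _ _ : Fin 1 => MvPolynomial.C c)) ⇑finSumFinEquiv.symm ⇑finSumFinEquiv.symm) i j) := by
  rw [Matrix.submatrix_apply]
  rcases finSumFinEquiv.symm i with a | a <;> rcases finSumFinEquiv.symm j with b | b
  · rw [Matrix.fromBlocks_apply₁₁, Matrix.mvPolynomialX_apply]; exact VOC_X _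
  · rw [Matrix.fromBlocks_apply₁₂]; exact VOC_zero
  · rw [Matrix.fromBlocks_apply₂₁]; exact VOC_zero
  · rw [Matrix.fromBlocks_apply₂₂]; exact VOC_C _

/-- **`per ≤_p cdet`**: the permanent family is a p-projection of the cycle-counting determinant:
`per_n = cdet_{N(n)}` of the averaging graph of `X ⊕ (c_n)`, `N(n) = 2(n+1) + (n+1)²`,
`c_n = ((-1)^{N(n)} q_n)⁻¹`. [folklore] -/
theorem isPProjection_perPoly_cdetPoly :
    IsPProjection (fun n => perPoly (Fin n) ℂ) (fun n => cdetPoly (Fin n) ℂ) := by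
  refine ⟨fun n => 2 * (n + 1) + (n + 1) * (n + 1),
    IsPBounded.add_holds
      (IsPBounded.mul_holds (IsPBounded.const 2) (IsPBounded.add_holds IsPBounded.id (IsPBounded.const 1)))
      (IsPBounded.mul_holds (IsPBounded.add_holds IsPBounded.id (IsPBounded.const 1))
        (IsPBounded.add_holds IsPBounded.id (IsPBounded.const 1))), fun n => ?_⟩
  -- the scalar of the reduction and its inverse
  have hq : (-1 : ℂ) ^ (2 * (n + 1) + (n + 1) * (n + 1)) *
      (((if n = 0 then (-1 : ℤ) else ((n - 1).factorial : ℤ)) : ℤ) : ℂ) ≠ 0 :=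
    mul_ne_zero (pow_ne_zero _ (by norm_num)) (by exact_mod_cast qScalar_ne_zero n)
  set c : ℂ := ((-1 : ℂ) ^ (2 * (n + 1) + (n + 1) * (n + 1)) *
      (((if n = 0 then (-1 : ℤ) else ((n - 1).factorial : ℤ)) : ℤ) : ℂ))⁻¹ with hc
  -- the padded generic matrix `X ⊕ (c)` and the averaging graph, reindexed by `Fin N(n)`
  set Z : Matrix (Fin (n + 1)) (Fin (n + 1)) (MvPolynomial (Fin n × Fin n) ℂ) :=
    Matrix.submatrix (Matrix.fromBlocks (Matrix.mvPolynomialX (Fin n) (Fin n) ℂ) 0 0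
      (fun _ _ : Fin 1 => MvPolynomial.C c)) ⇑finSumFinEquiv.symm ⇑finSumFinEquiv.symm with hZ
  let e : WB (n + 1) ((n + 1) * (n + 1)) ≃ Fin (2 * (n + 1) + (n + 1) * (n + 1)) :=
    Fintype.equivFinOfCardEq (card_WB _ _)
  refine ⟨fun pq => MB (0 : MvPolynomial (Fin n × Fin n) ℂ) Z ((n + 1) * (n + 1)) (fun _ => none)
      (e.symm pq.1) (e.symm pq.2), fun pq => MB_VOC _ (fun i j => ?_) _ _ _ _, ?_⟩
  · rw [hZ]; exact pad_VOC n c i j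
  · rw [aeval_MB_cdetPoly n Z e, hZ, permanent_pad n c, ← mul_assoc, ← map_mul, hc,
      mul_inv_cancel₀ hq, map_one, one_mul]

end PerToCdet

/-! ### `HC ≤_p per` from Valiant's completeness theorem, and the composition -/

section HcToPer

/-- Un-renaming a projection: if `rename e g` is a projection of `f` for an equivalence `e` of
variable types, so is `g`. [folklore] -/
theorem isProjection_of_rename_equiv {σ τ τ' : Type*} (e : τ ≃ τ') {g : MvPolynomial τ ℂ}
    {f : MvPolynomial σ ℂ} (h : IsProjection (MvPolynomial.rename e g) f) : IsProjection g f := by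
  obtain ⟨a, ha, hga⟩ := h
  refine ⟨fun i => MvPolynomial.rename e.symm (a i), fun i => ?_, ?_⟩
  · rcases ha i with ⟨j, hj⟩ | ⟨c, hc⟩
    · exact Or.inl ⟨e.symm j, by simp only [hj, MvPolynomial.rename_X]⟩
    · exact Or.inr ⟨c, by simp only [hc, MvPolynomial.rename_C]⟩
  · have h1 := congrArg (MvPolynomial.rename e.symm) hga
    rw [MvPolynomial.rename_rename, e.symm_comp_self, MvPolynomial.rename_id_apply] at h1
    rw [h1, ← AlgHom.comp_apply, MvPolynomial.comp_aeval]

/-- **`HC ≤_p per` over `ℂ`**: by Valiant's completeness theorem for the permanent (tree: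
`isVNPComplete_perPoly_holds`, `char ℂ = 0 ≠ 2`) applied to `HC ∈ VNP` (`isVNPFamily_hcPoly_holds`),
after bundling the variables along `Fin n × Fin n ≃ Fin (n·n)`. [folklore] -/
theorem isPProjection_hcPoly_perPoly :
    IsPProjection (fun n => hcPoly (Fin n) ℂ) (fun n => perPoly (Fin n) ℂ) := by
  have h2 : ringChar ℂ ≠ 2 := by rw [ringChar.eq_zero]; norm_num
  have hg : IsVNPFamily
      (fun n => MvPolynomial.renameEquiv ℂ (finProdFinEquiv (m := n) (n := n)) (hcPoly (Fin n) ℂ)) :=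
    IsVNPFamily.renameEquiv (fun n => finProdFinEquiv) (isVNPFamily_hcPoly_holds ℂ)
  obtain ⟨t, ht, hproj⟩ := (isVNPComplete_perPoly_holds ℂ h2).2 (fun n => n * n) _ hg
  exact ⟨t, ht, fun n => isProjection_of_rename_equiv finProdFinEquiv (hproj n)⟩

end HcToPer

end FermionicJetHcProjectsToCdet

open FermionicJetHcProjectsToCdet in
/-- Settles `stmt-ValiantsHypothesis-5342` (`HcProjectsToCdet`, route `FermionicJet`): the Hamiltonian
cycle family `(HC_n)_n` is a p-projection of the cycle-counting determinant
`cdet_n = ∑_σ sgn σ · c(σ) · ∏ᵢ X_{σ i, i}`; hence `cdet` is `VNP`-complete under p-projections over `ℂ` and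
the route's `FirstOrderHardness` is equivalent to `VP ≠ VNP`. Proof: `HC ≤_p per` (Valiant) and
`per ≤_p cdet` by the averaging graph — its return layer symmetrises the sign away
(`∑_{ψ ∈ S_m} sgn ψ λ^{c(ψ)} = λ(λ-1)⋯(λ-m+1)` vanishes at the free-fermion point `λ = 1` but has nonzero
derivative `(-1)^m (m-2)!` there). [folklore] -/
theorem hcProjectsToCdet_proof :
    Summit.ValiantsHypothesis.ValiantsHypothesis.Theses.FermionicJet.HcProjectsToCdet :=
  IsPProjection.trans_holds isPProjection_hcPoly_perPoly isPProjection_perPoly_cdetPoly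

end Summit.ValiantsHypothesis.ValiantsHypothesis.Theorems
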